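import Summits.Ventures.CertifiedQuantumChemistry.Rows.V2RDMDualKernel
import HarnessLib


/-!
# Ventures/CertifiedQuantumChemistry — Rows/V2RDMDualKernelSliced.lean: the staged kernel certificate with ROW-SLICED PSD blocks

HONEST FRAMING (verbatim): certified bounds for a stated model Hamiltonian in a stated basis; not a
claim about the real molecule beyond that model.

OFFERED FILE (pub-qchem-rdm = rdm-A, generation 62, 2026-08-23; ZERO compute: no kit job, no solver run). The typer owns `Summits/…`
and decides whether and where it lands. CHECK EVIDENCE: direct `lean check` of this exact file: rc 0, 0 warnings, 0 sorries
(Lean farm, 2026-08-23T08:01Z, 10.2 s); every kernel fact of the `Certificates/H10Sto6gR1786*` / `H10Sto6gR178655DQGKernel*` files was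
re-checked against THIS text inlined (the scratch checks are listed in those files' headers).

WHAT THIS FILE IS. `Rows/V2RDMDualKernel.lean` checks a staged dual certificate `SCert` with ONE kernel
chunk per BATCH of whole PSD blocks (`SCert.chunkRows`, `lowerRow_of_staged`); a block of dimension `d`
costs all `d²` ordered entry pairs inside one `decide +kernel`. For the 𝒢-blocks of the `k = 10`
half-filled sectors (`d = 100`: `10⁴` pairs, `2·10⁴` raw terms) one such chunk exceeds the kernel's
per-declaration memory budget (measured 2026-08-23 on the farm: every chunk with `≥ 10⁴` pairs fails with
`(kernel) excessive memory consumption`, chunks of `≤ 3.6·10³` pairs pass in ≈ 30 s). This file adds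
ROW-SLICED blocks: a block with a cut list `ns` (`Σ ns = d`, checked by `SCertS.valid`) contributes one
chunk per slice of `n` consecutive first indices `i` (and all `j`), i.e. `n·d` pairs per chunk
(`slicePieces`, `sliceRows`, `SCertS.chunkRows`). Soundness is the SAME weak-duality argument as
`lowerRow_of_staged`: the slices of a block have, in total, the value of `blockPieces` (`sliceRows_val`,
by `List.range'` concatenation), which is `≤ 0` on the DQG-feasible set (`blockPieces_val_le`); nothing is
claimed about an individual slice. Whole small blocks may still be batched (`SCertS.batches`), exactly as
before. The MERGES are staged too (same memory budget) and use `mergeRuns`: the residuals being merged are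
each already sorted by key, so the fuelled bottom-up merge is run on the RUNS (depth `log₂ #runs`) instead of
on singletons (`mergeGroup`/`sortTerms`, depth `log₂ #terms`, which exhausts the kernel on ≳ 10⁴ terms); only the
permutation property is used, so soundness does not depend on sortedness. The chunk residuals are merged in
consecutive groups (`takeGroups gs₁`, one `decide +kernel` per group against a literal), the group results once
more (`gs₂`), and `SCertS.finalCheck` merges the objective polynomial with the second-stage literals; by
`termsVal_mergeRuns` and `takeGroups_flatten` the value bookkeeping is that of `lowerRow_of_staged`.
`isObjPoly_of_runs` is the matching two-stage form of `isObjPoly_of_chunks` for the objective polynomial.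
Entry point: `lowerRow_of_sliced`.

Nothing here is specific to one molecule; the first user is `Certificates/H10Sto6gR178655DQGKernelLower.lean`
(CERTIFIED.md row #78).
-/

namespace Summit.Ventures.CertifiedQuantumChemistry

open Matrix Finset
open scoped ComplexOrder
open Literature.MathematicalPhysics.QuantumLattice Literature.MathematicalPhysics.QuantumChemistry

namespace V2RDMDual

section Semantics

variable {k : ℕ} [NeZero k] {γ : M1 k} {Γ : M2 k}

/-! ## Slices of a block -/

/-- The pieces of the rows `i ∈ [i₀, i₀ + n)` of a block (all columns `j`). -/
def slicePieces (κ : BKind) (mem : List (ℕ × ℕ)) (L : List (List ℤ)) (s : ℚ) (i₀ n : ℕ) : List Row :=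
  (List.range' i₀ n).flatMap fun i => (List.range mem.length).flatMap fun j => piece κ mem L s i j

/-- The slice rows of a block for a cut list, starting at row `i₀`: one collected row per cut. -/
def sliceRows (κ : BKind) (mem : List (ℕ × ℕ)) (L : List (List ℤ)) (s : ℚ) : ℕ → List ℕ → List Row
  | _, [] => []
  | i₀, n :: ns => collect (slicePieces κ mem L s i₀ n) :: sliceRows κ mem L s (i₀ + n) ns

/-- One slice row per cut. -/
theorem sliceRows_length (κ : BKind) (mem : List (ℕ × ℕ)) (L : List (List ℤ)) (s : ℚ) :
    ∀ (i₀ : ℕ) (ns : List ℕ), (sliceRows κ mem L s i₀ ns).length = ns.length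
  | _, [] => rfl
  | i₀, n :: ns => by rw [sliceRows, List.length_cons, List.length_cons, sliceRows_length κ mem L s (i₀ + n) ns]

/-- The slice rows of a cut list have, in total, the value of the pieces of the rows `[i₀, i₀ + Σ ns)`. -/
theorem sliceRows_val (κ : BKind) (mem : List (ℕ × ℕ)) (L : List (List ℤ)) (s : ℚ) :
    ∀ (i₀ : ℕ) (ns : List ℕ), rowsVal (k := k) (γ := γ) (Γ := Γ) (sliceRows κ mem L s i₀ ns) =
      rowsVal (k := k) (γ := γ) (Γ := Γ) (slicePieces κ mem L s i₀ ns.sum)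
  | i₀, [] => by simp [sliceRows, slicePieces]
  | i₀, n :: ns => by
    rw [sliceRows, rowsVal_cons, collect_val, sliceRows_val κ mem L s (i₀ + n) ns, List.sum_cons, slicePieces,
      slicePieces, slicePieces, ← rowsVal_append, ← List.flatMap_append, List.range'_append_1]

/-- All slices from row `0` with `Σ ns = d`: the value of the whole block form. -/
theorem sliceRows_val_eq_blockPieces (κ : BKind) (mem : List (ℕ × ℕ)) (L : List (List ℤ)) (s : ℚ) {ns : List ℕ}
    (hns : ns.sum = mem.length) :
    rowsVal (k := k) (γ := γ) (Γ := Γ) (sliceRows κ mem L s 0 ns) =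
      rowsVal (k := k) (γ := γ) (Γ := Γ) (blockPieces κ mem L s) := by
  rw [sliceRows_val, hns, slicePieces, blockPieces, List.range_eq_range']

/-! ## Consecutive groups of a list (for the staged final merge) -/

/-- Consecutive groups of a list with the given sizes (the remainder is dropped). -/
def takeGroups {α : Type*} : List ℕ → List α → List (List α)
  | [], _ => []
  | n :: ns, l => l.take n :: takeGroups ns (l.drop n)

omit [NeZero k] in
/-- One group per size. -/
theorem takeGroups_length {α : Type*} : ∀ (ns : List ℕ) (l : List α), (takeGroups ns l).length = ns.length
  | [], _ => rfl
  | n :: ns, l => by rw [takeGroups, List.length_cons, List.length_cons, takeGroups_length ns (l.drop n)]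

omit [NeZero k] in
/-- Groups whose sizes sum to the length of the list concatenate back to the list. -/
theorem takeGroups_flatten {α : Type*} : ∀ (ns : List ℕ) (l : List α), ns.sum = l.length → (takeGroups ns l).flatten = l
  | [], l, h => by rw [List.sum_nil] at h; rw [takeGroups, List.flatten_nil, eq_comm, ← List.length_eq_zero_iff, ← h]
  | n :: ns, l, h => by
    rw [List.sum_cons] at h
    have hn : n ≤ l.length := by omega
    rw [takeGroups, List.flatten_cons, takeGroups_flatten ns (l.drop n) (by rw [List.length_drop]; omega),
      List.take_append_drop]

/-! ## Merging already-sorted runs -/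

/-- Merge canonical term lists that are each already sorted by key: key-tag every term, fuelled bottom-up merge of
the RUNS (`mergeAll` at depth `log₂ #runs`, not from singletons), un-tag, group adjacent equal moments. Sound for
arbitrary inputs (only `mergeAll_perm` is used); grouping is complete when the runs are sorted. -/
def mergeRuns (n : ℕ) (ls : List (List Term)) : List Term :=
  group ((mergeAll ls.length (ls.map fun l => l.map fun t => (t.2.key n, t))).map Prod.snd)

/-- Merging runs preserves the total value. -/
theorem termsVal_mergeRuns (n : ℕ) (ls : List (List Term)) :
    termsVal k γ Γ (mergeRuns n ls) = (ls.map (termsVal k γ Γ)).sum := by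
  have hp := ((mergeAll_perm ls.length (ls.map fun l => l.map fun t => (t.2.key n, t))).map Prod.snd)
  have hf : ((ls.map fun l => l.map fun t => (t.2.key n, t)).flatten).map Prod.snd = ls.flatten := by
    rw [List.map_flatten, List.map_map]
    congr 1
    conv_rhs => rw [← List.map_id ls]
    refine List.map_congr_left fun l _ => ?_
    rw [Function.comp_apply, List.map_map, id]
    conv_rhs => rw [← List.map_id l]
    exact List.map_congr_left fun t _ => rfl
  rw [mergeRuns, termsVal_group, termsVal_perm hp, hf, termsVal_flatten]

/-- One merge STAGE through literals: if every consecutive group of `L` merges to the corresponding entry of `M`,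
the total value of `M` is that of `L`. -/
theorem sum_termsVal_stage (n : ℕ) (gs : List ℕ) (L M : List (List Term)) (q : ℕ) (hq : gs.length = q)
    (hgs : gs.sum = L.length) (hMl : M.length = q)
    (hM : ∀ g : Fin q, mergeRuns n ((takeGroups gs L).getD g []) = M.getD g []) :
    (M.map (termsVal k γ Γ)).sum = (L.map (termsVal k γ Γ)).sum := by
  have hlenG : (takeGroups gs L).length = q := by rw [takeGroups_length, hq]
  rw [← takeGroups_flatten gs L hgs, List.map_flatten, List.sum_flatten, List.map_map, sum_map_eq_sum_fin _ [] M,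
    sum_map_eq_sum_fin _ [] (takeGroups gs L), hMl, hlenG]
  refine Finset.sum_congr rfl fun g _ => ?_
  rw [Function.comp_apply, ← hM g, termsVal_mergeRuns]

/-- **Objective polynomial by staged run merges**: the chunk residuals `R` (`isObjPoly_of_chunks`' hypothesis) merged
in consecutive groups `gs` to the literals `M` (one kernel fact each), and `M` merged to `P`. -/
theorem isObjPoly_of_runs (F : Model k) (R : Fin k → List Term)
    (hR : ∀ p : Fin k, residual (2 * k) (objChunk F p) = R p)
    (gs : List ℕ) (M : List (List Term)) (q : ℕ) (hq : gs.length = q) (hgs : gs.sum = k) (hMl : M.length = q)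
    (hM : ∀ g : Fin q, mergeRuns (2 * k) ((takeGroups gs (List.ofFn R)).getD g []) = M.getD g [])
    (P : List Term) (hP : mergeRuns (2 * k) M = P) : IsObjPoly F P := by
  intro N γ' Γ' h
  have h0 := isObjPoly_of_chunks F R hR N γ' Γ' h
  rw [termsVal_mergeGroup] at h0
  rw [← hP, termsVal_mergeRuns, ← h0]
  exact sum_termsVal_stage (2 * k) gs (List.ofFn R) M q hq (by rw [hgs, List.length_ofFn]) hMl hM

/-! ## The sliced staged certificate -/

/-- A sliced block: a block with its cut list (slice heights, summing to the block dimension). -/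
abbrev SBlock := Block × List ℕ

/-- A STAGED dual certificate with batches of whole PSD blocks and row-sliced big PSD blocks. -/
structure SCertS where
  /-- Gram factors are read as `L Lᵀ / 4^K`. -/
  K : ℕ
  /-- multipliers of the rows of `rowList k a b`, in order. -/
  lam : List ℚ
  /-- whole PSD blocks, in batches (one kernel chunk per batch). -/
  batches : List (List Block)
  /-- row-sliced PSD blocks (one kernel chunk per slice). -/
  sliced : List SBlock
  /-- the claimed lower bound. -/
  lo : ℚ

/-- Number of chunks: the λ-row chunk, one per batch, one per slice. -/
def SCertS.numChunks (c : SCertS) : ℕ := c.batches.length + (c.sliced.map fun sb => sb.2.length).sum + 1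

variable (k) in
/-- The certificate's chunks as rows: the λ-scaled equality rows, one row per batch of whole blocks, then one
row per slice of each sliced block. -/
def SCertS.chunkRows (a b : ℕ) (c : SCertS) : List Row :=
  collect (lamRows c.lam (rowList k a b)) ::
    ((c.batches.map fun bt => collect (bt.flatMap fun blk => blockPieces blk.1 blk.2.1 blk.2.2 (1 / 4 ^ c.K))) ++
      c.sliced.flatMap fun sb => sliceRows sb.1.1 sb.1.2.1 sb.1.2.2 (1 / 4 ^ c.K) 0 sb.2)

variable (k) in
/-- Member validity of every block, and every cut list sums to its block's dimension. -/
def SCertS.valid (c : SCertS) : Bool :=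
  (c.batches.all fun bt => bt.all fun blk => blockValid (2 * k) blk.2.1) &&
    c.sliced.all fun sb => blockValid (2 * k) sb.1.2.1 && decide (sb.2.sum = sb.1.2.1.length)

/-- **Final (small) check**: validity, chunk count, the two merge stages' group sizes and literal counts
(`gs₁` over the chunk residuals → `M₁`, `gs₂` over `M₁` → `M₂`), and
`lo ≤ E_core + Σ chunk constants − ℓ¹(mergeRuns of the objective polynomial `P` with `M₂`)`. -/
def SCertS.finalCheck (F : Model k) (c : SCertS) (P : List Term) (R : List (ℚ × List Term)) (gs₁ : List ℕ)
    (M₁ : List (List Term)) (gs₂ : List ℕ) (M₂ : List (List Term)) : Bool :=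
  SCertS.valid k c && decide (R.length = c.numChunks) && decide (gs₁.sum = R.length) && decide (M₁.length = gs₁.length) &&
    decide (gs₂.sum = M₁.length) && decide (M₂.length = gs₂.length) &&
    decide (c.lo ≤ F.ecore + (R.map Prod.fst).sum - l1 (mergeRuns (2 * k) (P :: M₂)))

omit [NeZero k] in
/-- `SCertS.finalCheck` from its three parts, so that a certificate file may give the kernel the validity check, the (cheap)
length bookkeeping and the final ℓ¹ inequality as SEPARATE declarations (each its own kernel budget) instead of one. -/
theorem SCertS.finalCheck_of_parts (F : Model k) (c : SCertS) (P : List Term) (R : List (ℚ × List Term)) (gs₁ : List ℕ)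
    (M₁ : List (List Term)) (gs₂ : List ℕ) (M₂ : List (List Term)) (hv : SCertS.valid k c = true)
    (hlen : (decide (R.length = c.numChunks) && decide (gs₁.sum = R.length) && decide (M₁.length = gs₁.length) &&
      decide (gs₂.sum = M₁.length) && decide (M₂.length = gs₂.length)) = true)
    (hineq : decide (c.lo ≤ F.ecore + (R.map Prod.fst).sum - l1 (mergeRuns (2 * k) (P :: M₂))) = true) :
    SCertS.finalCheck F c P R gs₁ M₁ gs₂ M₂ = true := by
  simp only [SCertS.finalCheck, Bool.and_eq_true] at hlen ⊢
  exact ⟨⟨⟨⟨⟨⟨hv, hlen.1.1.1.1⟩, hlen.1.1.1.2⟩, hlen.1.1.2⟩, hlen.1.2⟩, hlen.2⟩, hineq⟩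

omit [NeZero k] in
/-- The chunk count of `SCertS.chunkRows`. -/
theorem SCertS.chunkRows_length (a b : ℕ) (c : SCertS) : (SCertS.chunkRows k a b c).length = c.numChunks := by
  simp only [SCertS.chunkRows, SCertS.numChunks, List.length_cons, List.length_append, List.length_map,
    List.length_flatMap, sliceRows_length]

/-- Weak duality for the sliced staged certificate: nonpositive total value on the sector-feasible set. -/
theorem SCertS.chunkRows_val_le {a b : ℕ} (c : SCertS) (h : IsDQGFeasibleSector a b γ Γ) (hab : a + b ≠ 0)
    (hr : a + b + 2 ≤ Fintype.card (Orb (Fin k))) (hv : SCertS.valid k c = true) :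
    rowsVal (k := k) (γ := γ) (Γ := Γ) (SCertS.chunkRows k a b c) ≤ 0 := by
  simp only [SCertS.valid, Bool.and_eq_true, List.all_eq_true, decide_eq_true_eq] at hv
  obtain ⟨hvB, hvS⟩ := hv
  rw [SCertS.chunkRows, rowsVal_cons, collect_val, lamRows_val (lam := c.lam) (rowList_val (k := k) h hab), zero_add,
    rowsVal_append]
  apply add_nonpos
  · rw [rowsVal, List.map_map]
    apply list_sum_nonpos
    intro x hx
    rw [List.mem_map] at hx
    obtain ⟨bt, hbt, rfl⟩ := hx
    rw [Function.comp_apply, collect_val, rowsVal_flatMap]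
    apply list_sum_nonpos
    intro y hy
    rw [List.mem_map] at hy
    obtain ⟨blk, hblk, rfl⟩ := hy
    exact blockPieces_val_le h.dqg hr blk.1 blk.2.1 blk.2.2 (by positivity) (hvB bt hbt blk hblk)
  · rw [rowsVal_flatMap]
    apply list_sum_nonpos
    intro x hx
    rw [List.mem_map] at hx
    obtain ⟨sb, hsb, rfl⟩ := hx
    obtain ⟨hv1, hv2⟩ := hvS sb hsb
    rw [sliceRows_val_eq_blockPieces sb.1.1 sb.1.2.1 sb.1.2.2 _ hv2]
    exact blockPieces_val_le h.dqg hr sb.1.1 sb.1.2.1 sb.1.2.2 (by positivity) hv1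

end Semantics

/-- **SLICED STAGED KERNEL ENTRY POINT** (large blocks): as `lowerRow_of_staged`, one literal per chunk of
`SCertS.chunkRows` (`hR`), one literal per group merge in each of the two merge stages (`hM₁`, `hM₂`), and the
final check. -/
theorem lowerRow_of_sliced {k : ℕ} [NeZero k] (F : Model k) (hF : F.IsSymmetric) (a b : ℕ) (ha : a ≤ k) (hb : b ≤ k)
    (hab : a + b ≠ 0) (hcard : a + b + 2 ≤ 2 * k) (c : SCertS) (P : List Term) (hP : IsObjPoly F P)
    (R : List (ℚ × List Term)) (m : ℕ) (hm : c.numChunks = m)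
    (hR : ∀ i : Fin m, chunkOut (2 * k) ((SCertS.chunkRows k a b c).getD i (0, [])) = R.getD i (0, []))
    (gs₁ : List ℕ) (M₁ : List (List Term)) (q₁ : ℕ) (hq₁ : gs₁.length = q₁)
    (hM₁ : ∀ g : Fin q₁, mergeRuns (2 * k) ((takeGroups gs₁ (R.map Prod.snd)).getD g []) = M₁.getD g [])
    (gs₂ : List ℕ) (M₂ : List (List Term)) (q₂ : ℕ) (hq₂ : gs₂.length = q₂)
    (hM₂ : ∀ g : Fin q₂, mergeRuns (2 * k) ((takeGroups gs₂ M₁).getD g []) = M₂.getD g [])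
    (hfin : SCertS.finalCheck F c P R gs₁ M₁ gs₂ M₂ = true) : LowerRow F a b c.lo := by
  refine ⟨ha, hb, ?_⟩
  simp only [SCertS.finalCheck, Bool.and_eq_true, decide_eq_true_eq] at hfin
  obtain ⟨⟨⟨⟨⟨⟨hv, hlen⟩, hgs₁⟩, hM₁l⟩, hgs₂⟩, hM₂l⟩, hlo⟩ := hfin
  show ((c.lo : ℚ) : ℝ) ≤ sectorGroundEnergy F.hamiltonian a b
  refine le_sectorGroundEnergy_of_forall_isDQGFeasibleSector (Model.hamiltonian_isHermitian hF)
    (by simpa using ha) (by simpa using hb) fun γ Γ hfeas => ?_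
  have hr : a + b + 2 ≤ Fintype.card (Orb (Fin k)) := by rw [card_orb_fin]; exact hcard
  rw [re_rdmEnergy_eq]
  have hchunks := SCertS.chunkRows_val_le (k := k) (γ := γ) (Γ := Γ) c hfeas hab hr hv
  have hlenC : (SCertS.chunkRows k a b c).length = m := by rw [SCertS.chunkRows_length, hm]
  have hlenR : R.length = m := by rw [hlen, hm]
  -- the chunk values through the literals
  have e1 : rowsVal (k := k) (γ := γ) (Γ := Γ) (SCertS.chunkRows k a b c) =
      ((R.map Prod.fst).sum : ℚ) + ((R.map Prod.snd).map (termsVal k γ Γ)).sum := by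
    rw [rowsVal, sum_map_eq_sum_fin _ (0, []), List.map_map, sum_map_eq_sum_fin _ (0, []) R,
      sum_map_eq_sum_fin _ (0, []) R, hlenC, hlenR]
    push_cast
    rw [← Finset.sum_add_distrib]
    refine Finset.sum_congr rfl fun i _ => ?_
    have hi := hR i
    simp only [chunkOut, Prod.ext_iff] at hi
    rw [rowVal, hi.1, Function.comp_apply, ← hi.2, termsVal_residual hfeas.dqg]
  -- the two merge stages through the literals
  have eM₁ : (M₁.map (termsVal k γ Γ)).sum = ((R.map Prod.snd).map (termsVal k γ Γ)).sum :=
    sum_termsVal_stage (2 * k) gs₁ (R.map Prod.snd) M₁ q₁ hq₁ (by rw [hgs₁, List.length_map]) (by rw [hM₁l, hq₁]) hM₁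
  have eM₂ : (M₂.map (termsVal k γ Γ)).sum = (M₁.map (termsVal k γ Γ)).sum :=
    sum_termsVal_stage (2 * k) gs₂ M₁ M₂ q₂ hq₂ hgs₂ (by rw [hM₂l, hq₂]) hM₂
  have e2 : termsVal k γ Γ (mergeRuns (2 * k) (P :: M₂)) =
      termsVal k γ Γ (objTerms F) + ((R.map Prod.snd).map (termsVal k γ Γ)).sum := by
    rw [termsVal_mergeRuns, List.map_cons, List.sum_cons, hP _ γ Γ hfeas.dqg, eM₂, eM₁]
  have e3 := neg_l1_le (abs_val_le_one (k := k) hfeas.dqg hr) (mergeRuns (2 * k) (P :: M₂))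
  have h3 : ((c.lo : ℚ) : ℝ) ≤ (F.ecore : ℝ) + ((R.map Prod.fst).sum : ℚ) -
      (l1 (mergeRuns (2 * k) (P :: M₂)) : ℝ) := by exact_mod_cast hlo
  linarith

end V2RDMDual

end Summit.Ventures.CertifiedQuantumChemistry
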